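import Mathlib.CategoryTheory.InducedCategory
import Mathlib.CategoryTheory.Equivalence
import Mathlib.Algebra.Category.MonCat.Basic
import Literature.AlgebraicGeometry.Frobenioids.Frobenioid
import Literature.AlgebraicGeometry.Frobenioids.CoAngular
import HarnessLib

/-!
# Frobenioids I, §2: the functor `O^▷(−)` (Proposition 2.2)

Mochizuki, *The geometry of Frobenioids I*, Kyushu J. Math. **62** (2008), §2, Proposition 2.2
"The Functor `O^▷(−)`", kurims pp. 45–46 [cite: MochizukiFrdI2008, Prop. 2.2 p.45].  Standing
data: `F : C ⥤ ElemFrobenioid Φ` a Frobenioid (`hF : IsFrobenioid F` where used).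

* `D*`: the category whose objects are the objects of `C^istr` and whose morphisms are
  `Hom_{D*}(A, B) := Hom_D(A_D, B_D)`; the natural functors `C^istr → D* → D`.
* **(i)** `D* → D` is an equivalence of categories — PROVED (`dstarToBase_isEquivalence`).
* **(ii)** there is a unique contravariant functor `D* → Mon`, `A ↦ O^▷(A)`, such that for
  `φ : A → B` in `C^istr`: (a) if `φ` is linear, `O^▷(φ_{D*}) : O^▷(B) → O^▷(A)` is the inclusion of
  Prop. 1.11 (iv); (b) if `φ` is a pre-step it is the [inverse of the] bijection of
  Def. 1.3 (iii)(c).  Both maps are characterised by `β ∘ φ = φ ∘ α` (`β ↦ α`), so the functor is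
  rendered as the data `UnitsFunctorData F` (restriction maps `res f : O^▷(B) → O^▷(A)` for
  `f : A_D → B_D`, functorial, satisfying that relation for linear `φ`) packaged as an honest functor
  `(D*)ᵒᵖ ⥤ MonCat` (`UnitsFunctorData.functor`); existence and uniqueness are recorded as the
  statement `UnitsFunctorExistsUnique` (its proof, p. 46, uses Prop. 1.11 (iv) and
  Def. 1.3 (i)(c), (iii)(c) — L1-t1's Prop. 1.11 is not yet available; TODO).
* **(iii)** `O^×(A) = O^▷(A)^±` (PROVED: `isUnit_endSubmonoid_iff`), `Div` is a homomorphism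
  `O^▷(A) → Φ(A)` (PROVED: `divHom`), natural for linear arrows (PROVED: `pull_div_res`), inducing an
  injection `O^▷(A)^char = O^▷(A)/O^×(A) ↪ Φ(A)` (PROVED: `div_eq_div_iff_associated`, from
  Def. 1.3 (vi)).
* **(iv)** an isotropic hull `φ : A → A^istr` induces a natural injection `O^▷(A) ↪ O^▷(A^istr)`
  (PROVED: `hullMap`, `hullMap_injective`).
Composition is diagrammatic; `End A` multiplies by `f * g = g ≫ f`.
-/

noncomputable section

namespace Literature.AlgebraicGeometry.Frobenioids

open CategoryTheory Opposite

universe w v v' u u'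

namespace PreFrobenioid

variable {D : Type u} [Category.{v} D] {Φ : Dᵒᵖ ⥤ CommMonCat.{w}}
  {C : Type u'} [Category.{v'} C] (F : C ⥤ ElemFrobenioid Φ)

/-! ### The category `D*` and the functors `C^istr → D* → D` -/

/-- The category `D*` of Prop. 2.2: objects the objects of `C^istr`, morphisms
`Hom_{D*}(A, B) := Hom_D(A_D, B_D)` — the category structure induced from `D` along
`A ↦ A_D = Base(A)`. [cite: MochizukiFrdI2008, Prop. 2.2 p.45] -/
def DStar : Type u' :=
  InducedCategory D (fun A : (isotropicObjects F).FullSubcategory => baseObj F A.obj)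

/-- `D*` is a category (induced from `D`). [cite: MochizukiFrdI2008, Prop. 2.2 p.45] -/
instance DStar.instCategory : Category (DStar F) :=
  inferInstanceAs (Category (InducedCategory D
    (fun A : (isotropicObjects F).FullSubcategory => baseObj F A.obj)))

/-- The natural functor `D* → D`, `A ↦ A_D`. [cite: MochizukiFrdI2008, Prop. 2.2 p.45] -/
def dstarToBase : DStar F ⥤ D :=
  inducedFunctor (fun A : (isotropicObjects F).FullSubcategory => baseObj F A.obj)

/-- `D* → D` is full (by construction of `D*`). [cite: MochizukiFrdI2008, Prop. 2.2(i) p.45] -/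
instance dstarToBase_full : (dstarToBase F).Full :=
  inferInstanceAs (inducedFunctor
    (fun A : (isotropicObjects F).FullSubcategory => baseObj F A.obj)).Full

/-- `D* → D` is faithful (by construction of `D*`). [cite: MochizukiFrdI2008, Prop. 2.2(i) p.45] -/
instance dstarToBase_faithful : (dstarToBase F).Faithful :=
  inferInstanceAs (inducedFunctor
    (fun A : (isotropicObjects F).FullSubcategory => baseObj F A.obj)).Faithful

/-- The natural functor `C^istr → D*`, the identity on objects and `φ ↦ Base(φ)` on arrows
("the natural projection functor `C → D` determines natural functors `C^istr → D* → D`").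
[cite: MochizukiFrdI2008, Prop. 2.2 p.45] -/
def istrToDStar : (isotropicObjects F).FullSubcategory ⥤ DStar F where
  obj A := A
  map φ := InducedCategory.homMk (Base F φ.hom)
  map_id A := InducedCategory.hom_ext (base_id F A.obj)
  map_comp φ ψ := InducedCategory.hom_ext (base_comp F φ.hom ψ.hom)

/-- `C^istr → D* → D` is the projection `C^istr ⊆ C → D` (`0`-commutativity).
[cite: MochizukiFrdI2008, Prop. 2.2 p.45] -/
theorem istrToDStar_comp_dstarToBase :
    istrToDStar F ⋙ dstarToBase F = (isotropicObjects F).ι ⋙ baseFunctor F := rfl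

/-- **Prop. 2.2 (i)**: `D* → D` is an equivalence of categories — it is fully faithful by
construction, and essentially surjective by Def. 1.3 (i)(a) together with the existence of
isotropic hulls (vii)(a) (the text applies (i)(a) to the Frobenioid `C^istr`, Prop. 1.9 (v)).
[cite: MochizukiFrdI2008, Prop. 2.2(i) p.45] -/
theorem dstarToBase_isEquivalence (hF : IsFrobenioid F) : (dstarToBase F).IsEquivalence := by
  haveI : (dstarToBase F).EssSurj := ⟨fun X => by
    obtain ⟨A, -, ⟨e⟩⟩ := hF.i_a X
    obtain ⟨B, φ, hφ⟩ := hF.vii_a A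
    haveI : IsIso (Base F φ) := hφ.2.1.2
    exact ⟨(⟨B, hφ.2.2.1⟩ : (isotropicObjects F).FullSubcategory),
      ⟨(asIso (Base F φ)).symm ≪≫ e⟩⟩⟩
  exact {}

/-! ### Proposition 2.2 (ii): the functor `O^▷(−)` on `D*` -/

/-- The data of a contravariant functor `D* → Mon`, `A ↦ O^▷(A)`: for each arrow `f : A_D → B_D`
of `D*` a homomorphism `O^▷(f) : O^▷(B) → O^▷(A)`, functorially, such that for a linear
`φ : A → B` of `C^istr`, `O^▷(Base φ)` is the map `β ↦ α` with `β ∘ φ = φ ∘ α` — i.e. (a) the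
inclusion of Prop. 1.11 (iv) and, for pre-steps, (b) the inverse of the bijection of
Def. 1.3 (iii)(c) (Prop. 2.2 (ii)). [cite: MochizukiFrdI2008, Prop. 2.2(ii) p.45] -/
structure UnitsFunctorData : Type (max u' v v') where
  /-- `O^▷(f) : O^▷(B) → O^▷(A)` for `f : A_D → B_D`, `A, B` isotropic -/
  res : ∀ {A B : (isotropicObjects F).FullSubcategory},
    (baseObj F A.obj ⟶ baseObj F B.obj) → (endSubmonoid F B.obj →* endSubmonoid F A.obj)
  /-- functoriality: identities -/
  res_id : ∀ (A : (isotropicObjects F).FullSubcategory) (α : endSubmonoid F A.obj),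
    res (𝟙 (baseObj F A.obj)) α = α
  /-- functoriality: composites (contravariant) -/
  res_comp : ∀ {A B B' : (isotropicObjects F).FullSubcategory} (f : baseObj F A.obj ⟶ baseObj F B.obj)
    (g : baseObj F B.obj ⟶ baseObj F B'.obj) (γ : endSubmonoid F B'.obj),
    res (f ≫ g) γ = res f (res g γ)
  /-- (a)/(b): on (the projection of) a linear arrow `φ : A → B`, `O^▷(φ)` sends `β` to the `α`
  with `β ∘ φ = φ ∘ α` -/
  res_base : ∀ {A B : (isotropicObjects F).FullSubcategory} (φ : A.obj ⟶ B.obj), IsLinear F φ →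
    ∀ β : endSubmonoid F B.obj,
      φ ≫ (show B.obj ⟶ B.obj from β.1) = (show A.obj ⟶ A.obj from (res (Base F φ) β).1) ≫ φ

namespace UnitsFunctorData

variable {F} (O : UnitsFunctorData F)

/-- The functor `O^▷(−) : (D*)ᵒᵖ → Mon` packaged from the data (values in `MonCat`; the monoids
`O^▷(A)` are commutative by Remark 1.3.1). [cite: MochizukiFrdI2008, Prop. 2.2(ii) p.45] -/
def functor : (DStar F)ᵒᵖ ⥤ MonCat.{v'} where
  obj A := MonCat.of (endSubmonoid F (unop A).obj)
  map f := MonCat.ofHom (O.res f.unop.hom)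
  map_id A := by
    apply MonCat.hom_ext
    rw [MonCat.hom_ofHom, MonCat.hom_id]
    exact MonoidHom.ext fun α => O.res_id (unop A) α
  map_comp f g := by
    apply MonCat.hom_ext
    rw [MonCat.hom_ofHom, MonCat.hom_comp, MonCat.hom_ofHom, MonCat.hom_ofHom]
    exact MonoidHom.ext fun γ => O.res_comp g.unop.hom f.unop.hom γ

/-- "By abuse of notation, … the restriction of this functor on `D*` to `(C^istr)^lin`": the value
on a linear arrow of `C^istr`. [cite: MochizukiFrdI2008, Prop. 2.2(ii) p.45] -/
abbrev resLin {A B : (isotropicObjects F).FullSubcategory} (φ : A.obj ⟶ B.obj) :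
    endSubmonoid F B.obj →* endSubmonoid F A.obj :=
  O.res (Base F φ)

/-- "By applying the equivalence of categories of (i), we obtain a contravariant functor `D → Mon`,
… well-defined up to isomorphism": transport along a quasi-inverse of `D* → D`.
[cite: MochizukiFrdI2008, Prop. 2.2(ii) p.45] -/
def functorOnBase [(dstarToBase F).IsEquivalence] : Dᵒᵖ ⥤ MonCat.{v'} :=
  (dstarToBase F).inv.op ⋙ O.functor

end UnitsFunctorData

/-- **Prop. 2.2 (ii)** (statement): "There is a unique contravariant functor `D* → Mon`,
`A ↦ O^▷(A)`" with properties (a), (b) — existence and uniqueness of `UnitsFunctorData`.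
[cite: MochizukiFrdI2008, Prop. 2.2(ii) p.45] -/
def UnitsFunctorExistsUnique : Prop :=
  Nonempty (UnitsFunctorData F) ∧ Subsingleton (UnitsFunctorData F)

/-! ### Proposition 2.2 (iii): units, and `Div : O^▷(A) → Φ(A)` -/

/-- A base-identity linear endomorphism is a pre-step. [cite: MochizukiFrdI2008, Prop. 2.2(iii) p.45] -/
theorem isPreStep_of_mem_endSubmonoid {A : C} (e : endSubmonoid F A) :
    IsPreStep F (show A ⟶ A from e.1) :=
  ⟨e.2.2, by
    have h : Base F (show A ⟶ A from e.1) = 𝟙 _ := e.2.1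
    show IsIso (Base F (show A ⟶ A from e.1))
    rw [h]
    infer_instance⟩

/-- **Prop. 2.2 (iii)**, first part: "`O^×(A) (⊆ O^▷(A))` … is equal to … `O^▷(A)^±`" — an element of
`O^▷(A)` is invertible in `O^▷(A)` iff it underlies an element of `O^×(A)`.
[cite: MochizukiFrdI2008, Prop. 2.2(iii) p.45] -/
theorem isUnit_endSubmonoid_iff {A : C} (e : endSubmonoid F A) :
    IsUnit e ↔ ∃ α ∈ unitsSubgroup F A, α.hom = (show A ⟶ A from e.1) := by
  constructor
  · rintro ⟨u, hu⟩
    -- `u⁻¹` is a two-sided inverse in `End A`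
    have h₁ : (show A ⟶ A from (u⁻¹ : (endSubmonoid F A)ˣ).1.1) ≫ (show A ⟶ A from u.1.1) = 𝟙 A :=
      congrArg (fun x : (endSubmonoid F A)ˣ => (x.1.1 : End A)) (mul_inv_cancel u)
    have h₂ : (show A ⟶ A from u.1.1) ≫ (show A ⟶ A from (u⁻¹ : (endSubmonoid F A)ˣ).1.1) = 𝟙 A :=
      congrArg (fun x : (endSubmonoid F A)ˣ => (x.1.1 : End A)) (inv_mul_cancel u)
    refine ⟨⟨_, _, h₂, h₁⟩, ⟨?_, ?_⟩, ?_⟩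
    · exact hu ▸ u.1.2.1
    · exact hu ▸ u.1.2.2
    · rw [← hu]
  · rintro ⟨α, hα, hαe⟩
    have hinv := (unitsSubgroup F A).inv_mem hα
    refine ⟨⟨e, ⟨α.inv, hinv.1, hinv.2⟩, ?_, ?_⟩, rfl⟩
    · apply Subtype.ext
      show (show A ⟶ A from α.inv) ≫ (show A ⟶ A from e.1) = 𝟙 A
      rw [← hαe, α.inv_hom_id]
    · apply Subtype.ext
      show (show A ⟶ A from e.1) ≫ (show A ⟶ A from α.inv) = 𝟙 A
      rw [← hαe, α.hom_inv_id]

variable {F} in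
/-- **Prop. 2.2 (iii)**, subfunctor: any `O^▷(f)` carries `O^▷(B)^±` into `O^▷(A)^±` (so
`A ↦ O^×(A)` is a subfunctor of the functor of (ii)). [cite: MochizukiFrdI2008, Prop. 2.2(iii) p.45] -/
theorem UnitsFunctorData.isUnit_res (O : UnitsFunctorData F) {A B : (isotropicObjects F).FullSubcategory}
    (f : baseObj F A.obj ⟶ baseObj F B.obj) {β : endSubmonoid F B.obj} (hβ : IsUnit β) :
    IsUnit (O.res f β) :=
  hβ.map _

/-- **Prop. 2.2 (iii)**: "the operation `Div(−)` determines a … homomorphism `O^▷(A) → Φ(A)`"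
(`Div(α ∘ β) = Div(α) + Div(β)` for base-identity linear `α, β`, by Remark 1.1.1).
[cite: MochizukiFrdI2008, Prop. 2.2(iii) p.45] -/
def divHom (A : C) : endSubmonoid F A →* Φ.obj (op (baseObj F A)) where
  toFun e := Div F (show A ⟶ A from e.1)
  map_one' := div_id F A
  map_mul' e e' := by
    show Div F ((show A ⟶ A from e'.1) ≫ (show A ⟶ A from e.1)) = _
    rw [div_comp, show Base F (show A ⟶ A from e'.1) = 𝟙 _ from e'.2.1, pull_id,
      show degFr F (show A ⟶ A from e.1) = 1 from e.2.2, PNat.one_coe, pow_one]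

/-- `divHom` on an element. [cite: MochizukiFrdI2008, Prop. 2.2(iii) p.45] -/
@[simp] theorem divHom_apply (A : C) (e : endSubmonoid F A) :
    divHom F A e = Div F (show A ⟶ A from e.1) := rfl

variable {F} in
/-- **Prop. 2.2 (iii)**, "functorial": for a linear `φ : A → B` in `C^istr` and `β ∈ O^▷(B)`,
`Div(O^▷(φ)(β)) = φ^* Div(β)` (cancel `Div(φ)` in the integral monoid `Φ(A)` from the two
expansions of `Div(β ∘ φ) = Div(φ ∘ α)`). [cite: MochizukiFrdI2008, Prop. 2.2(iii) p.45] -/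
theorem UnitsFunctorData.pull_div_res (hF : IsFrobenioid F) (O : UnitsFunctorData F)
    {A B : (isotropicObjects F).FullSubcategory} (φ : A.obj ⟶ B.obj) (hφ : IsLinear F φ)
    (β : endSubmonoid F B.obj) :
    divHom F A.obj (O.res (Base F φ) β) = pull Φ (Base F φ) (divHom F B.obj β) := by
  have h := congrArg (Div F) (O.res_base φ hφ β)
  rw [div_comp, div_comp, show degFr F (show B.obj ⟶ B.obj from β.1) = 1 from β.2.2,
    show Base F (show A.obj ⟶ A.obj from (O.res (Base F φ) β).1) = 𝟙 _ from (O.res (Base F φ) β).2.1,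
    pull_id, show degFr F φ = 1 from hφ, PNat.one_coe, pow_one, pow_one, mul_comm] at h
  haveI : IsCancelMul (Φ.obj (op (baseObj F A.obj))) :=
    isIntegral_iff_isCancelMul.mp (hF.isPreFrobenioid.isDivisorial (baseObj F A.obj)).isPreDivisorial.isIntegral
  exact (mul_left_cancel h).symm

variable {F} in
/-- **Prop. 2.2 (iii)**, "functorial" for all of `D*` (statement): `Div ∘ O^▷(f) = f^* ∘ Div` for
every arrow `f : A_D → B_D` of `D*` (the linear case is `pull_div_res`; the general case follows
from the construction of (ii)). [cite: MochizukiFrdI2008, Prop. 2.2(iii) p.45] -/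
def UnitsFunctorData.DivNatural (O : UnitsFunctorData F) : Prop :=
  ∀ {A B : (isotropicObjects F).FullSubcategory} (f : baseObj F A.obj ⟶ baseObj F B.obj)
    (β : endSubmonoid F B.obj), divHom F A.obj (O.res f β) = pull Φ f (divHom F B.obj β)

/-- Units of `O^▷(A)` have trivial divisor (`Φ(A)` is sharp). [cite: MochizukiFrdI2008, Prop. 2.2(iii) p.45] -/
theorem divHom_eq_one_of_isUnit (hF : IsPreFrobenioid Φ F) {A : C} {e : endSubmonoid F A}
    (he : IsUnit e) : divHom F A e = 1 :=
  (hF.isDivisorial (baseObj F A)).isSharp.1 _ (he.map (divHom F A))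

/-- **Prop. 2.2 (iii)**: `Div` "induces an inclusion `O^▷(A)^char = O^▷(A)/O^×(A) ↪ Φ(A)`": two
elements of `O^▷(A)` have the same divisor iff they are associated (differ by a unit) — the
non-trivial direction is Def. 1.3 (vi) (base-identity linear endomorphisms are co-angular pre-steps).
[cite: MochizukiFrdI2008, Prop. 2.2(iii) p.45] -/
theorem div_eq_div_iff_associated (hF : IsFrobenioid F) {A : C} (e e' : endSubmonoid F A) :
    divHom F A e = divHom F A e' ↔ Associated e e' := by
  constructor
  · intro h
    have he : IsCoAngularPreStep F (show A ⟶ A from e.1) :=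
      ⟨isCoAngular_endo F hF _, isPreStep_of_mem_endSubmonoid F e⟩
    have he' : IsCoAngularPreStep F (show A ⟶ A from e'.1) :=
      ⟨isCoAngular_endo F hF _, isPreStep_of_mem_endSubmonoid F e'⟩
    have hb : BaseEquivalent F (show A ⟶ A from e'.1) (show A ⟶ A from e.1) := e'.2.1.trans e.2.1.symm
    obtain ⟨α, hα, hαe⟩ := hF.vi _ _ he' he hb h.symm
    -- `e ≫ α = e'`, i.e. `e' = α * e` in `End A`; the unit is `α`
    obtain ⟨u, hu⟩ := (isUnit_endSubmonoid_iff F ⟨α.hom, hα⟩).mpr ⟨α, hα, rfl⟩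
    refine ⟨u, ?_⟩
    rw [endSubmonoid_comm F hF e ↑u, hu]
    apply Subtype.ext
    exact hαe
  · rintro ⟨u, rfl⟩
    rw [map_mul, divHom_eq_one_of_isUnit F hF.isPreFrobenioid u.isUnit, mul_one]

/-- Associated elements of `O^▷(A)` have the same divisor (units have divisor `0`).
[cite: MochizukiFrdI2008, Prop. 2.2(iii) p.45] -/
theorem divHom_eq_of_associated (hF : IsPreFrobenioid Φ F) {A : C} {e e' : endSubmonoid F A}
    (h : Associated e e') : divHom F A e = divHom F A e' := by
  obtain ⟨u, rfl⟩ := h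
  rw [map_mul, divHom_eq_one_of_isUnit F hF u.isUnit, mul_one]

/-- **Prop. 2.2 (iii)**: the map `O^▷(A)^char = O^▷(A)/O^×(A) → Φ(A)` induced by `Div`
(well defined by `divHom_eq_of_associated`). [cite: MochizukiFrdI2008, Prop. 2.2(iii) p.45] -/
def charDiv (hF : IsPreFrobenioid Φ F) (A : C) :
    Associates (endSubmonoid F A) → Φ.obj (op (baseObj F A)) :=
  Quotient.lift (divHom F A) fun _ _ h => divHom_eq_of_associated F hF h

/-- `charDiv` on a class. [cite: MochizukiFrdI2008, Prop. 2.2(iii) p.45] -/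
@[simp] theorem charDiv_mk (hF : IsPreFrobenioid Φ F) {A : C} (e : endSubmonoid F A) :
    charDiv F hF A (Associates.mk e) = divHom F A e := rfl

/-- **Prop. 2.2 (iii)**: `O^▷(A)^char ↪ Φ(A)` is injective ("induces an inclusion").
[cite: MochizukiFrdI2008, Prop. 2.2(iii) p.45] -/
theorem charDiv_injective (hF : IsFrobenioid F) (A : C) :
    Function.Injective (charDiv F hF.isPreFrobenioid A) := by
  intro x y h
  obtain ⟨e, rfl⟩ := Associates.mk_surjective x
  obtain ⟨e', rfl⟩ := Associates.mk_surjective y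
  exact Associates.mk_eq_mk_iff_associated.mpr ((div_eq_div_iff_associated F hF e e').mp h)

/-! ### Proposition 2.2 (iv): isotropic hulls -/

section Hull

variable {F} {A B : C} {φ : A ⟶ B} (hφ : IsIsotropicHull F φ)

/-- For an isotropic hull `φ : A → A^istr` and `α ∈ O^▷(A)`, the unique `β : A^istr → A^istr` with
`β ∘ φ = φ ∘ α` (universal property of the hull). [cite: MochizukiFrdI2008, Prop. 2.2(iv) p.45] -/
def hullLift (α : A ⟶ A) : B ⟶ B := (hφ.2.2.2 (α ≫ φ) hφ.2.2.1).exists.choose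

/-- The defining square of `hullLift`. [cite: MochizukiFrdI2008, Prop. 2.2(iv) p.45] -/
theorem hullLift_spec (α : A ⟶ A) : φ ≫ hullLift hφ α = α ≫ φ :=
  (hφ.2.2.2 (α ≫ φ) hφ.2.2.1).exists.choose_spec

/-- Uniqueness of `hullLift`. [cite: MochizukiFrdI2008, Prop. 2.2(iv) p.45] -/
theorem hullLift_unique (α : A ⟶ A) (β : B ⟶ B) (hβ : φ ≫ β = α ≫ φ) : β = hullLift hφ α :=
  (hφ.2.2.2 (α ≫ φ) hφ.2.2.1).unique hβ (hullLift_spec hφ α)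

/-- **Prop. 2.2 (iv)**: an isotropic hull `φ : A → A^istr` "determines a natural inclusion of monoids
`O^▷(A) ↪ O^▷(A^istr)`", `α ↦` the unique `β` with `β ∘ φ = φ ∘ α` (a base-identity linear
endomorphism since `Base(φ)` is an isomorphism and `φ` is linear). [cite: MochizukiFrdI2008, Prop. 2.2(iv) p.45] -/
def hullMap : endSubmonoid F A →* endSubmonoid F B where
  toFun α := ⟨hullLift hφ (show A ⟶ A from α.1), by
    have hsq := hullLift_spec hφ (show A ⟶ A from α.1)
    haveI : IsIso (Base F φ) := hφ.2.1.2
    refine ⟨?_, ?_⟩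
    · have hb := congrArg (Base F) hsq
      rw [base_comp, base_comp, show Base F (show A ⟶ A from α.1) = 𝟙 _ from α.2.1,
        Category.id_comp] at hb
      have hb' : Base F φ ≫ Base F (hullLift hφ (show A ⟶ A from α.1)) = Base F φ ≫ 𝟙 _ := by
        rw [hb, Category.comp_id]
      exact cancel_epi (Base F φ) |>.mp hb'
    · have hd := congrArg (degFr F) hsq
      rw [degFr_comp, degFr_comp, show degFr F (show A ⟶ A from α.1) = 1 from α.2.2,
        show degFr F φ = 1 from hφ.2.1.1, one_mul, one_mul] at hd
      exact hd⟩
  map_one' := by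
    apply Subtype.ext
    symm
    apply hullLift_unique hφ
    show φ ≫ 𝟙 B = 𝟙 A ≫ φ
    rw [Category.comp_id, Category.id_comp]
  map_mul' α α' := by
    apply Subtype.ext
    symm
    apply hullLift_unique hφ
    show φ ≫ hullLift hφ (show A ⟶ A from α'.1) ≫ hullLift hφ (show A ⟶ A from α.1) =
      ((show A ⟶ A from α'.1) ≫ (show A ⟶ A from α.1)) ≫ φ
    rw [← Category.assoc, hullLift_spec, Category.assoc, hullLift_spec, Category.assoc]

/-- The defining relation of `hullMap`: `β ∘ φ = φ ∘ α`. [cite: MochizukiFrdI2008, Prop. 2.2(iv) p.45] -/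
theorem hullMap_spec (α : endSubmonoid F A) :
    φ ≫ (show B ⟶ B from (hullMap hφ α).1) = (show A ⟶ A from α.1) ≫ φ :=
  hullLift_spec hφ _

/-- **Prop. 2.2 (iv)**, injectivity: `O^▷(A) → O^▷(A^istr)` is injective, since an isotropic hull
(a pre-step) is a monomorphism (Def. 1.3 (v)(a)). [cite: MochizukiFrdI2008, Prop. 2.2(iv) p.45] -/
theorem hullMap_injective (hF : IsFrobenioid F) : Function.Injective (hullMap (F := F) hφ) := by
  intro α α' h
  haveI : Mono φ := hF.v_a φ hφ.2.1
  have h1 := hullMap_spec hφ α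
  have h2 := hullMap_spec hφ α'
  rw [h] at h1
  apply Subtype.ext
  exact (cancel_mono φ).mp (h1.symm.trans h2)

end Hull

end PreFrobenioid

end Literature.AlgebraicGeometry.Frobenioids
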